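import Summits.CriticalPhenomena.PercolationContinuityZ3.Theorems.PercNearOneGluingNoHeavyLowerTailStarSetPairRowPointwise
import HarnessLib

/-!
# `NoHeavyLowerTail` (stmt-CriticalPhenomena-4575) — the PAIR-ROW certificate, pointwise (level `j ≤ 2`, any two-port star multigraph)

Support file (prover `prim-gen-swap` gen 9; `--supports stmt-CriticalPhenomena-4575`).  No definitions, no named facts, no sorries.

Seat memo MWF-CERT.md §1–§2: for a multigraph of two-port pendant stars with classes `K : Fin M` (class ports `P K ≠ P' K`, distinct port
pairs), the relay-pair row of class `K` taken with multiplier `D_K = Θ_K · Zfar_K` (`Θ_K` the class weight, `Zfar_K` the product of `1 − Θ`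
over the classes sharing no port with `K`) pays EXACTLY the lonely term of `K` in the comonotone word, in every configuration; the price is
paid only where `c` is light, and is covered by the hair budget (the words with `≥ 3` designated ports) under the two explicit supply
hypotheses `hG0`, `hG1` (memo: G0, G1_r).  This file proves the resulting certificate POINTWISE in the configuration off the stars:

* `StarSet.pairRow_certificate_pointwise` — for every `ω`,
  `C0·Σ_S W(S)(1[D₁ S] − 1[D₂ S]) + Σ_t b_t·Σ_S W(S)1[B_t S] ≥ C0·Σ_K D_K·Σ_S W(S)(1[ρ_K S] − 1[ℓ_K S])`,
  where `D₁/D₂` are the cells of the comonotone word, `B_t` the budget cells of designated sets `R_t` (ports), and `ρ_K/ℓ_K` the two cells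
  of the pair row of `K` in the link-glued configurations (`StarSet.linkRow_le`).
Ingredients: `StarSet.pair_lonely_links`, `StarSet.classes_c_trichotomy`, `StarSet.portPattern_lonely_singleton'`, cylinder sums.
-/

noncomputable section

namespace Summit.CriticalPhenomena.PercolationContinuityZ3.Theorems

open MeasureTheory Set Literature.Probability.LatticeModels Literature.Probability.Percolation
open scoped Classical BigOperators

variable {n M : ℕ}

namespace StarSet

/-- Sums of a function vanishing off singletons, over the powerset. [folklore] -/
theorem sum_powerset_eq_sum_singletons {α : Type*} [Fintype α] [DecidableEq α] (f : Finset α → ℝ)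
    (hf : ∀ S : Finset α, (∀ a, S ≠ {a}) → f S = 0) :
    ∑ S ∈ (Finset.univ : Finset α).powerset, f S = ∑ a, f {a} := by
  have hsub : (Finset.univ : Finset α).image (fun a => ({a} : Finset α)) ⊆ (Finset.univ : Finset α).powerset :=
    fun S _ => Finset.mem_powerset.2 (Finset.subset_univ _)
  rw [← Finset.sum_subset hsub (fun S _ hS => hf S (fun a h => hS (Finset.mem_image.2 ⟨a, Finset.mem_univ _, h.symm⟩)))]
  rw [Finset.sum_image (fun a _ b _ h => Finset.singleton_injective h)]

/-- **The pair-row certificate, pointwise.**  See the file header.  Data: stars `s i` with ports `p i = P (cls i)`, `p' i = P' (cls i)`;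
`Θ_K = 1 − Π_{cls i = K}(1 − θ_i)`; `W(S) = Π_{K∈S}Θ_K Π_{K∉S}(1 − Θ_K)`; `D_K = Θ_K Π_{K' far from K}(1 − Θ_K')`; budget cells indexed by
`t : ι` with coefficients `b_t ≥ 0` and designated port sets `R_t`; supplies `hG0`, `hG1`. [MWF-CERT.md §1–§2] -/
theorem pairRow_certificate_pointwise {ι : Type*} [Fintype ι] (w : Sym2 (Fin n) → unitInterval) (A : Finset (Fin n)) {m : ℕ}
    (s p p' : Fin m → Fin n) (cls : Fin m → Fin M) (P P' : Fin M → Fin n)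
    (c : Fin n) (j : ℕ) (hj : j ≤ 2)
    (hPA : ∀ I, P I ∈ A) (hP'A : ∀ I, P' I ∈ A) (hPP' : ∀ I, P I ≠ P' I)
    (hnopar : ∀ I K : Fin M, I ≠ K → ¬ ((P K = P I ∨ P K = P' I) ∧ (P' K = P I ∨ P' K = P' I)))
    (hcA : c ∈ A) (hcP : ∀ I, c ≠ P I ∧ c ≠ P' I)
    (C0 : ℝ) (hC0 : 0 ≤ C0) (b : ι → ℝ) (hb : ∀ t, 0 ≤ b t) (R : ι → Finset (Fin n))
    (hRport : ∀ t, ∀ u ∈ R t, ∃ I, u = P I ∨ u = P' I)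
    (hG0 : C0 * ∑ K, ((1 - ∏ i ∈ Finset.univ.filter (fun i => cls i = K), (1 - (w s(s i, p i) : ℝ) * w s(s i, p' i))) *
        ∏ K' ∈ Finset.univ.filter (fun K' => ¬ (P K' = P K ∨ P K' = P' K ∨ P' K' = P K ∨ P' K' = P' K)),
          ∏ i ∈ Finset.univ.filter (fun i => cls i = K'), (1 - (w s(s i, p i) : ℝ) * w s(s i, p' i))) ≤ C0 + ∑ t, b t)
    (hG1 : ∀ r, C0 * ∑ K ∈ Finset.univ.filter (fun K => P K ≠ r ∧ P' K ≠ r),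
        ((1 - ∏ i ∈ Finset.univ.filter (fun i => cls i = K), (1 - (w s(s i, p i) : ℝ) * w s(s i, p' i))) *
        ∏ K' ∈ Finset.univ.filter (fun K' => ¬ (P K' = P K ∨ P K' = P' K ∨ P' K' = P K ∨ P' K' = P' K)),
          ∏ i ∈ Finset.univ.filter (fun i => cls i = K'), (1 - (w s(s i, p i) : ℝ) * w s(s i, p' i))) ≤
        C0 + ∑ t ∈ Finset.univ.filter (fun t => r ∉ R t), b t)
    (ω : BondConfig (Fin n)) :
    C0 * ∑ K, (((1 - ∏ i ∈ Finset.univ.filter (fun i => cls i = K), (1 - (w s(s i, p i) : ℝ) * w s(s i, p' i))) *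
        ∏ K' ∈ Finset.univ.filter (fun K' => ¬ (P K' = P K ∨ P K' = P' K ∨ P' K' = P K ∨ P' K' = P' K)),
          ∏ i ∈ Finset.univ.filter (fun i => cls i = K'), (1 - (w s(s i, p i) : ℝ) * w s(s i, p' i))) *
      ∑ S ∈ (Finset.univ : Finset (Fin M)).powerset,
        ((∏ K ∈ S, (1 - ∏ i ∈ Finset.univ.filter (fun i => cls i = K), (1 - (w s(s i, p i) : ℝ) * w s(s i, p' i)))) *
          ∏ K ∈ Finset.univ \ S, ∏ i ∈ Finset.univ.filter (fun i => cls i = K), (1 - (w s(s i, p i) : ℝ) * w s(s i, p' i))) *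
        (DecisionTree.ind {ω' : BondConfig (Fin n) |
            (∀ u ∈ ({K} : Finset (Fin M)).image P ∪ ({K} : Finset (Fin M)).image P',
              ¬ (openGraph ((ω' ∩ {e | ∀ v ∈ Finset.univ.image s, v ∉ e}) ∪ ↑(S.image fun I => (s(P I, P' I) : Sym2 (Fin n))))).Reachable c u) ∧
            (A.filter fun z => (openGraph ((ω' ∩ {e | ∀ v ∈ Finset.univ.image s, v ∉ e}) ∪
              ↑(S.image fun I => (s(P I, P' I) : Sym2 (Fin n))))).Reachable c z).card ≤ j} ω -
          DecisionTree.ind {ω' : BondConfig (Fin n) |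
            (∀ u ∈ ({K} : Finset (Fin M)).image P ∪ ({K} : Finset (Fin M)).image P',
              ¬ (openGraph ((ω' ∩ {e | ∀ v ∈ Finset.univ.image s, v ∉ e}) ∪ ↑(S.image fun I => (s(P I, P' I) : Sym2 (Fin n))))).Reachable c u) ∧
            1 ≤ (A.filter fun z => ∃ u ∈ ({K} : Finset (Fin M)).image P ∪ ({K} : Finset (Fin M)).image P',
              (openGraph ((ω' ∩ {e | ∀ v ∈ Finset.univ.image s, v ∉ e}) ∪ ↑(S.image fun I => (s(P I, P' I) : Sym2 (Fin n))))).Reachable u z).card ∧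
            (A.filter fun z => ∃ u ∈ ({K} : Finset (Fin M)).image P ∪ ({K} : Finset (Fin M)).image P',
              (openGraph ((ω' ∩ {e | ∀ v ∈ Finset.univ.image s, v ∉ e}) ∪ ↑(S.image fun I => (s(P I, P' I) : Sym2 (Fin n))))).Reachable u z).card ≤ j} ω)) ≤
    C0 * ∑ S ∈ (Finset.univ : Finset (Fin M)).powerset,
        ((∏ K ∈ S, (1 - ∏ i ∈ Finset.univ.filter (fun i => cls i = K), (1 - (w s(s i, p i) : ℝ) * w s(s i, p' i)))) *
          ∏ K ∈ Finset.univ \ S, ∏ i ∈ Finset.univ.filter (fun i => cls i = K), (1 - (w s(s i, p i) : ℝ) * w s(s i, p' i))) *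
        (DecisionTree.ind {ω' : BondConfig (Fin n) |
            (∀ u ∈ S.image P ∪ S.image P', ¬ (openGraph (ω' ∩ {e | ∀ v ∈ Finset.univ.image s, v ∉ e})).Reachable c u) ∧
            (A.filter fun z => (openGraph (ω' ∩ {e | ∀ v ∈ Finset.univ.image s, v ∉ e})).Reachable c z).card ≤ j} ω -
          DecisionTree.ind {ω' : BondConfig (Fin n) |
            (∀ u ∈ S.image P ∪ S.image P', ¬ (openGraph (ω' ∩ {e | ∀ v ∈ Finset.univ.image s, v ∉ e})).Reachable c u) ∧
            1 ≤ (A.filter fun z => ∃ u ∈ S.image P ∪ S.image P',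
              (openGraph (ω' ∩ {e | ∀ v ∈ Finset.univ.image s, v ∉ e})).Reachable u z).card ∧
            (A.filter fun z => ∃ u ∈ S.image P ∪ S.image P',
              (openGraph (ω' ∩ {e | ∀ v ∈ Finset.univ.image s, v ∉ e})).Reachable u z).card ≤ j} ω) +
      ∑ t, b t * ∑ S ∈ (Finset.univ : Finset (Fin M)).powerset,
        ((∏ K ∈ S, (1 - ∏ i ∈ Finset.univ.filter (fun i => cls i = K), (1 - (w s(s i, p i) : ℝ) * w s(s i, p' i)))) *
          ∏ K ∈ Finset.univ \ S, ∏ i ∈ Finset.univ.filter (fun i => cls i = K), (1 - (w s(s i, p i) : ℝ) * w s(s i, p' i))) *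
        DecisionTree.ind {ω' : BondConfig (Fin n) |
            (∀ u ∈ R t ∪ (S.image P ∪ S.image P'), ¬ (openGraph (ω' ∩ {e | ∀ v ∈ Finset.univ.image s, v ∉ e})).Reachable c u) ∧
            (A.filter fun z => (openGraph (ω' ∩ {e | ∀ v ∈ Finset.univ.image s, v ∉ e})).Reachable c z).card ≤ j} ω := by
  -- abbreviations
  set θ : Fin m → ℝ := fun i => (w s(s i, p i) : ℝ) * w s(s i, p' i) with hθ
  have hθ0 : ∀ i, 0 ≤ θ i := fun i => mul_nonneg (w _).2.1 (w _).2.1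
  have hθ1 : ∀ i, θ i ≤ 1 := fun i => mul_le_one₀ (w _).2.2 (w _).2.1 (w _).2.2
  set uu : Fin M → ℝ := fun K => ∏ i ∈ Finset.univ.filter (fun i => cls i = K), (1 - θ i) with huu
  have huu0 : ∀ K, 0 ≤ uu K := fun K => Finset.prod_nonneg fun i _ => sub_nonneg.2 (hθ1 i)
  have huu1 : ∀ K, uu K ≤ 1 := fun K => Finset.prod_le_one (fun i _ => sub_nonneg.2 (hθ1 i)) fun i _ => sub_le_self _ (hθ0 i)
  set Θ : Fin M → ℝ := fun K => 1 - uu K with hΘ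
  have hΘ0 : ∀ K, 0 ≤ Θ K := fun K => sub_nonneg.2 (huu1 K)
  have hΘ1 : ∀ K, Θ K ≤ 1 := fun K => sub_le_self _ (huu0 K)
  have hΘuu : ∀ K, 1 - Θ K = uu K := fun K => by simp only [hΘ, sub_sub_cancel]
  set W : Finset (Fin M) → ℝ := fun S => (∏ K ∈ S, Θ K) * ∏ K ∈ Finset.univ \ S, uu K with hW
  have hWnn : ∀ S, 0 ≤ W S := fun S => mul_nonneg (Finset.prod_nonneg fun K _ => hΘ0 K) (Finset.prod_nonneg fun K _ => huu0 K)
  set touch : Fin M → Fin M → Prop := fun K' K => P K' = P K ∨ P K' = P' K ∨ P' K' = P K ∨ P' K' = P' K with htouch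
  set D : Fin M → ℝ := fun K => Θ K * ∏ K' ∈ Finset.univ.filter (fun K' => ¬ touch K' K), uu K' with hD
  have hDnn : ∀ K, 0 ≤ D K := fun K => mul_nonneg (hΘ0 K) (Finset.prod_nonneg fun K' _ => huu0 K')
  -- cylinder sums in the `uu`-form
  have hcylU : ∀ Cl : Finset (Fin M), ∑ S ∈ (Finset.univ : Finset (Fin M)).powerset, W S * (if (∀ K ∈ Cl, K ∉ S) then (1 : ℝ) else 0) =
      ∏ K ∈ Cl, uu K := by
    intro Cl
    have h := cylinder_sum_closed Θ Cl
    simp only [hΘuu] at h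
    refine Eq.trans (Finset.sum_congr rfl fun S _ => ?_) h
    by_cases hS : ∀ K ∈ Cl, K ∉ S
    · rw [if_pos hS, if_pos hS]
    · rw [if_neg hS, if_neg hS]
  set ξ : BondConfig (Fin n) := ω ∩ {e | ∀ v ∈ Finset.univ.image s, v ∉ e} with hξ
  set L : Finset (Fin M) → Set (Sym2 (Fin n)) := fun S => ↑(S.image fun I => (s(P I, P' I) : Sym2 (Fin n))) with hL
  set RK : Fin M → Finset (Fin n) := fun K => ({K} : Finset (Fin M)).image P ∪ ({K} : Finset (Fin M)).image P' with hRK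
  set ρ : Fin M → Finset (Fin M) → Set (BondConfig (Fin n)) := fun K S => {ω' |
    (∀ u ∈ RK K, ¬ (openGraph ((ω' ∩ {e | ∀ v ∈ Finset.univ.image s, v ∉ e}) ∪ ↑(S.image fun I => (s(P I, P' I) : Sym2 (Fin n))))).Reachable c u) ∧
    (A.filter fun z => (openGraph ((ω' ∩ {e | ∀ v ∈ Finset.univ.image s, v ∉ e}) ∪
      ↑(S.image fun I => (s(P I, P' I) : Sym2 (Fin n))))).Reachable c z).card ≤ j} with hρ
  set ℓ : Fin M → Finset (Fin M) → Set (BondConfig (Fin n)) := fun K S => {ω' |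
    (∀ u ∈ RK K, ¬ (openGraph ((ω' ∩ {e | ∀ v ∈ Finset.univ.image s, v ∉ e}) ∪ ↑(S.image fun I => (s(P I, P' I) : Sym2 (Fin n))))).Reachable c u) ∧
    1 ≤ (A.filter fun z => ∃ u ∈ RK K,
      (openGraph ((ω' ∩ {e | ∀ v ∈ Finset.univ.image s, v ∉ e}) ∪ ↑(S.image fun I => (s(P I, P' I) : Sym2 (Fin n))))).Reachable u z).card ∧
    (A.filter fun z => ∃ u ∈ RK K,
      (openGraph ((ω' ∩ {e | ∀ v ∈ Finset.univ.image s, v ∉ e}) ∪ ↑(S.image fun I => (s(P I, P' I) : Sym2 (Fin n))))).Reachable u z).card ≤ j}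
    with hℓ
  set D₁ : Finset (Fin M) → Set (BondConfig (Fin n)) := fun S => {ω' |
    (∀ u ∈ S.image P ∪ S.image P', ¬ (openGraph (ω' ∩ {e | ∀ v ∈ Finset.univ.image s, v ∉ e})).Reachable c u) ∧
      (A.filter fun z => (openGraph (ω' ∩ {e | ∀ v ∈ Finset.univ.image s, v ∉ e})).Reachable c z).card ≤ j} with hD₁
  set D₂ : Finset (Fin M) → Set (BondConfig (Fin n)) := fun S => {ω' |
    (∀ u ∈ S.image P ∪ S.image P', ¬ (openGraph (ω' ∩ {e | ∀ v ∈ Finset.univ.image s, v ∉ e})).Reachable c u) ∧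
      1 ≤ (A.filter fun z => ∃ u ∈ S.image P ∪ S.image P',
        (openGraph (ω' ∩ {e | ∀ v ∈ Finset.univ.image s, v ∉ e})).Reachable u z).card ∧
      (A.filter fun z => ∃ u ∈ S.image P ∪ S.image P',
        (openGraph (ω' ∩ {e | ∀ v ∈ Finset.univ.image s, v ∉ e})).Reachable u z).card ≤ j} with hD₂
  set B : ι → Finset (Fin M) → Set (BondConfig (Fin n)) := fun t S => {ω' |
    (∀ u ∈ R t ∪ (S.image P ∪ S.image P'), ¬ (openGraph (ω' ∩ {e | ∀ v ∈ Finset.univ.image s, v ∉ e})).Reachable c u) ∧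
      (A.filter fun z => (openGraph (ω' ∩ {e | ∀ v ∈ Finset.univ.image s, v ∉ e})).Reachable c z).card ≤ j} with hB
  set G : Finset (Fin M) → Set (BondConfig (Fin n)) := fun S => {ω' |
    (A.filter fun z => (openGraph ((ω' ∩ {e | ∀ v ∈ Finset.univ.image s, v ∉ e}) ∪
      ↑(S.image fun I => (s(P I, P' I) : Sym2 (Fin n))))).Reachable c z).card ≤ j} with hG
  set PS : Finset (Finset (Fin M)) := (Finset.univ : Finset (Fin M)).powerset with hPS
  change C0 * ∑ K, D K * ∑ S ∈ PS, W S * (DecisionTree.ind (ρ K S) ω - DecisionTree.ind (ℓ K S) ω) ≤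
    C0 * ∑ S ∈ PS, W S * (DecisionTree.ind (D₁ S) ω - DecisionTree.ind (D₂ S) ω) +
      ∑ t, b t * ∑ S ∈ PS, W S * DecisionTree.ind (B t S) ω
  -- (0) `D₁ S = G S`
  have hΛ : ∀ S : Finset (Fin M), ∀ l ∈ S.image (fun I => (s(P I, P' I) : Sym2 (Fin n))),
      ∃ q q', l = s(q, q') ∧ q ≠ q' ∧ q ∈ A ∧ q' ∈ A ∧ q ≠ c ∧ q' ≠ c := by
    intro S l hl
    obtain ⟨I, -, rfl⟩ := Finset.mem_image.1 hl
    exact ⟨P I, P' I, rfl, hPP' I, hPA I, hP'A I, (hcP I).1.symm, (hcP I).2.symm⟩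
  have hi : ∀ S, DecisionTree.ind (D₁ S) ω = DecisionTree.ind (G S) ω := by
    intro S
    have key := sepSmall_links_iff ξ (S.image fun I => (s(P I, P' I) : Sym2 (Fin n))) A ∅ c j hj hcA (hΛ S)
    have hiff : ω ∈ D₁ S ↔ ω ∈ G S := by
      simp only [hD₁, hG, mem_setOf_eq]
      constructor
      · rintro ⟨hsep, hsmall⟩
        have h3 := key.1 ⟨fun y hy => absurd hy (Finset.notMem_empty y),
          fun l hl v hv => hsep v ((mem_portPattern_iff P P' S v).2 ⟨l, hl, hv⟩), by convert hsmall using 4⟩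
        convert h3.2 using 4
      · intro hsmall
        have h3 := key.2 ⟨fun y hy => absurd hy (Finset.notMem_empty y), by convert hsmall using 4⟩
        refine ⟨fun u hu => ?_, by convert h3.2.2 using 4⟩
        obtain ⟨l, hl, hul⟩ := (mem_portPattern_iff P P' S u).1 hu
        exact h3.2.1 l hl u hul
    by_cases hω : ω ∈ D₁ S
    · rw [DecisionTree.ind_of_mem hω, DecisionTree.ind_of_mem (hiff.1 hω)]
    · rw [DecisionTree.ind_of_not_mem hω, DecisionTree.ind_of_not_mem (fun h => hω (hiff.2 h))]
  -- (1) the lonely side: `Σ_S W 1[D₂ S] ≤ Σ_K D_K Σ_S W 1[ℓ_K S]`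
  have hD₂single : ∀ S, (∀ K, S ≠ {K}) → DecisionTree.ind (D₂ S) ω = 0 := by
    intro S hS
    refine DecisionTree.ind_of_not_mem fun hω => ?_
    simp only [hD₂, mem_setOf_eq] at hω
    obtain ⟨K, rfl⟩ := portPattern_lonely_singleton' ξ A P P' S j hj hPA hP'A hPP'
      (fun I _ K _ hIK => hnopar I K hIK) (hω.2.1.trans_eq (card_filter_congr fun _ _ => Iff.rfl))
      ((card_filter_congr fun _ _ => Iff.rfl).trans_le hω.2.2)
    exact hS K rfl
  have hlonelySum : ∑ S ∈ PS, W S * DecisionTree.ind (D₂ S) ω = ∑ K, W {K} * DecisionTree.ind (D₂ {K}) ω :=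
    sum_powerset_eq_sum_singletons (fun S => W S * DecisionTree.ind (D₂ S) ω) (fun S hS => by rw [hD₂single S hS, mul_zero])
  -- W{K} = D_K · Π_{touching, ≠ K}(1 − Θ)
  have hWK : ∀ K, W {K} = D K * ∏ K' ∈ Finset.univ.filter (fun K' => touch K' K ∧ K' ≠ K), uu K' := by
    intro K
    have hsplit : Finset.univ \ ({K} : Finset (Fin M)) =
        Finset.univ.filter (fun K' => ¬ touch K' K) ∪ Finset.univ.filter (fun K' => touch K' K ∧ K' ≠ K) := by
      ext K'
      simp only [Finset.mem_sdiff, Finset.mem_univ, Finset.mem_singleton, true_and, Finset.mem_union, Finset.mem_filter]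
      constructor
      · intro hne
        by_cases h : touch K' K
        · exact Or.inr ⟨h, hne⟩
        · exact Or.inl h
      · rintro (h | ⟨_, h⟩)
        · intro hK; apply h; rw [hK]; exact Or.inl rfl
        · exact h
    have hdisj : Disjoint (Finset.univ.filter (fun K' => ¬ touch K' K)) (Finset.univ.filter (fun K' => touch K' K ∧ K' ≠ K)) := by
      rw [Finset.disjoint_filter]; intro K' _ h h'; exact h h'.1
    simp only [hW, hD, Finset.prod_singleton]
    rw [hsplit, Finset.prod_union hdisj]
    ring
  have hpay : ∀ K, W {K} * DecisionTree.ind (D₂ {K}) ω ≤ D K * ∑ S ∈ PS, W S * DecisionTree.ind (ℓ K S) ω := by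
    intro K
    by_cases hω : ω ∈ D₂ {K}
    · have hmem := hω
      simp only [hD₂, mem_setOf_eq] at hω
      obtain ⟨hsep, -, hl⟩ := hω
      -- every pattern avoiding the classes touching `K` (other than `K`) keeps `R_K` lonely
      have hcyl := hcylU (Finset.univ.filter (fun K' => touch K' K ∧ K' ≠ K))
      have hge : ∑ S ∈ PS, W S * (if (∀ K' ∈ Finset.univ.filter (fun K' => touch K' K ∧ K' ≠ K), K' ∉ S) then (1 : ℝ) else 0) ≤
          ∑ S ∈ PS, W S * DecisionTree.ind (ℓ K S) ω := by
        refine Finset.sum_le_sum fun S _ => mul_le_mul_of_nonneg_left ?_ (hWnn S)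
        split_ifs with hfarS
        · refine le_of_eq (DecisionTree.ind_of_mem ?_).symm
          have hfar' : ∀ I ∈ S, I ≠ K → ¬ touch I K := fun I hI hIK h =>
            hfarS I (Finset.mem_filter.2 ⟨Finset.mem_univ _, h, hIK⟩) hI
          have h3 := pair_lonely_links ξ A P P' K S c j hj hPA hP'A hPP' hfar' hsep ((card_filter_congr fun _ _ => Iff.rfl).trans_le hl)
          simp only [hℓ, hRK, mem_setOf_eq]
          exact ⟨h3.1, h3.2.1.trans_eq (card_filter_congr fun _ _ => Iff.rfl), (card_filter_congr fun _ _ => Iff.rfl).trans_le h3.2.2⟩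
        · exact DecisionTree.ind_nonneg _ _
      rw [hcyl] at hge
      rw [DecisionTree.ind_of_mem hmem, mul_one, hWK K]
      exact mul_le_mul_of_nonneg_left hge (hDnn K)
    · rw [DecisionTree.ind_of_not_mem hω, mul_zero]
      exact mul_nonneg (hDnn K) (Finset.sum_nonneg fun S _ => mul_nonneg (hWnn S) (DecisionTree.ind_nonneg _ _))
  have hlonely : ∑ S ∈ PS, W S * DecisionTree.ind (D₂ S) ω ≤ ∑ K, D K * ∑ S ∈ PS, W S * DecisionTree.ind (ℓ K S) ω := by
    rw [hlonelySum]; exact Finset.sum_le_sum fun K _ => hpay K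
  -- (2) reduce to the `G`/`ρ`/`B` inequality
  have hsplitL : ∑ K, D K * ∑ S ∈ PS, W S * (DecisionTree.ind (ρ K S) ω - DecisionTree.ind (ℓ K S) ω) =
      ∑ K, D K * ∑ S ∈ PS, W S * DecisionTree.ind (ρ K S) ω - ∑ K, D K * ∑ S ∈ PS, W S * DecisionTree.ind (ℓ K S) ω := by
    rw [← Finset.sum_sub_distrib]
    refine Finset.sum_congr rfl fun K _ => ?_
    rw [← mul_sub, ← Finset.sum_sub_distrib]
    congr 1
    exact Finset.sum_congr rfl fun S _ => by ring
  have hsplitR : ∑ S ∈ PS, W S * (DecisionTree.ind (D₁ S) ω - DecisionTree.ind (D₂ S) ω) =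
      ∑ S ∈ PS, W S * DecisionTree.ind (G S) ω - ∑ S ∈ PS, W S * DecisionTree.ind (D₂ S) ω := by
    rw [← Finset.sum_sub_distrib]
    exact Finset.sum_congr rfl fun S _ => by rw [hi S]; ring
  rw [hsplitL, hsplitR]
  suffices hmain : C0 * ∑ K, D K * ∑ S ∈ PS, W S * DecisionTree.ind (ρ K S) ω ≤
      C0 * ∑ S ∈ PS, W S * DecisionTree.ind (G S) ω + ∑ t, b t * ∑ S ∈ PS, W S * DecisionTree.ind (B t S) ω by
    have := mul_le_mul_of_nonneg_left hlonely hC0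
    nlinarith
  -- (3) trichotomy
  have hρG : ∀ K S, DecisionTree.ind (ρ K S) ω ≤ DecisionTree.ind (G S) ω := by
    intro K S
    by_cases hω : ω ∈ ρ K S
    · have : ω ∈ G S := by
        simp only [hρ, mem_setOf_eq] at hω
        simp only [hG, mem_setOf_eq]
        exact hω.2
      rw [DecisionTree.ind_of_mem hω, DecisionTree.ind_of_mem this]
    · rw [DecisionTree.ind_of_not_mem hω]; exact DecisionTree.ind_nonneg _ _
  have hsumW : ∑ S ∈ PS, W S = 1 := by
    have h := hcylU (∅ : Finset (Fin M))
    simp only [Finset.notMem_empty, IsEmpty.forall_iff, implies_true, if_true, mul_one, Finset.prod_empty] at h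
    exact h
  rcases classes_c_trichotomy ξ A P P' c j hj hPA hP'A hPP' hcA hcP with hheavy | ⟨hlight, hfar, hsmall⟩ | ⟨r, hr, -, honly, hsmall, hGr, -⟩
  · -- (i) c heavy: every `ρ` vanishes
    have hρ0 : ∀ K S, DecisionTree.ind (ρ K S) ω = 0 := by
      intro K S
      refine DecisionTree.ind_of_not_mem fun hω => ?_
      simp only [hρ, mem_setOf_eq] at hω
      have := (hheavy S).trans_le ((card_filter_congr fun _ _ => Iff.rfl).trans_le hω.2)
      omega
    simp only [hρ0, mul_zero, Finset.sum_const_zero]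
    exact add_nonneg (mul_nonneg hC0 (Finset.sum_nonneg fun S _ => mul_nonneg (hWnn S) (DecisionTree.ind_nonneg _ _)))
      (Finset.sum_nonneg fun t _ => mul_nonneg (hb t) (Finset.sum_nonneg fun S _ => mul_nonneg (hWnn S) (DecisionTree.ind_nonneg _ _)))
  · -- (ii) c light, isolated from all ports: `G ≡ 1`, `B ≡ 1`
    have hG1' : ∀ S, DecisionTree.ind (G S) ω = 1 := fun S => DecisionTree.ind_of_mem (by
      simp only [hG, mem_setOf_eq]; exact (card_filter_congr fun _ _ => Iff.rfl).trans_le (hlight S))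
    have hB1 : ∀ t S, DecisionTree.ind (B t S) ω = 1 := by
      intro t S
      refine DecisionTree.ind_of_mem ?_
      simp only [hB, mem_setOf_eq]
      refine ⟨fun u hu => ?_, hsmall⟩
      rcases Finset.mem_union.1 hu with hu | hu
      · obtain ⟨I, hI⟩ := hRport t u hu
        rcases hI with rfl | rfl
        · exact (hfar I).1
        · exact (hfar I).2
      · rcases Finset.mem_union.1 hu with hu | hu
        · obtain ⟨I, -, rfl⟩ := Finset.mem_image.1 hu; exact (hfar I).1
        · obtain ⟨I, -, rfl⟩ := Finset.mem_image.1 hu; exact (hfar I).2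
    have hle : ∑ K, D K * ∑ S ∈ PS, W S * DecisionTree.ind (ρ K S) ω ≤ ∑ K, D K := by
      refine Finset.sum_le_sum fun K _ => ?_
      have : ∑ S ∈ PS, W S * DecisionTree.ind (ρ K S) ω ≤ 1 := by
        rw [← hsumW]
        exact Finset.sum_le_sum fun S _ => by
          have := mul_le_mul_of_nonneg_left (BHK2006.ind_le_one (ρ K S) ω) (hWnn S); simpa using this
      have := mul_le_mul_of_nonneg_left this (hDnn K); simpa using this
    simp only [hG1', hB1, mul_one, hsumW]
    have h0 := mul_le_mul_of_nonneg_left hle hC0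
    linarith [hG0]
  · -- (iii) c glued to exactly one port `r`
    set g : Finset (Fin M) → ℝ := fun S => DecisionTree.ind (G S) ω with hg
    have hgnn : ∀ S, 0 ≤ g S := fun S => DecisionTree.ind_nonneg _ _
    have hgiff : ∀ S, ω ∈ G S ↔ ∀ I ∈ S, P I ≠ r ∧ P' I ≠ r := by
      intro S
      simp only [hG, mem_setOf_eq]
      exact (iff_of_eq (congrArg (· ≤ j) (card_filter_congr fun _ _ => Iff.rfl))).trans (hGr S)
    -- `ρ_K ≡ 0` for classes at `r`
    have hρr : ∀ K, ¬ (P K ≠ r ∧ P' K ≠ r) → ∀ S, DecisionTree.ind (ρ K S) ω = 0 := by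
      intro K hK S
      refine DecisionTree.ind_of_not_mem fun hω => ?_
      simp only [hρ, hRK, mem_setOf_eq, Finset.image_singleton, Finset.mem_union, Finset.mem_singleton] at hω
      have hr' : ∀ u, u = r → ¬ (openGraph (ξ ∪ L S)).Reachable c u → False :=
        fun u hu h => h (by rw [hu]; exact reachable_mono_union ξ (L S) hr)
      by_cases h1 : P K = r
      · exact hr' (P K) h1 (hω.1 (P K) (Or.inl rfl))
      · have h2 : P' K = r := by by_contra h2; exact hK ⟨h1, h2⟩
        exact hr' (P' K) h2 (hω.1 (P' K) (Or.inr rfl))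
    -- budget cells with `r ∉ R_t` dominate `g`
    have hBg : ∀ t, r ∉ R t → ∀ S, g S ≤ DecisionTree.ind (B t S) ω := by
      intro t ht S
      by_cases hω : ω ∈ G S
      · have hS := (hgiff S).1 hω
        have : ω ∈ B t S := by
          simp only [hB, mem_setOf_eq]
          refine ⟨fun u hu hcu => ?_, hsmall⟩
          have huA : u ∈ A ∧ u ≠ c ∧ u ≠ r := by
            rcases Finset.mem_union.1 hu with hu | hu
            · obtain ⟨I, hI⟩ := hRport t u hu
              have hur : u ≠ r := fun h => ht (h ▸ hu)
              rcases hI with rfl | rfl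
              · exact ⟨hPA I, (hcP I).1.symm, hur⟩
              · exact ⟨hP'A I, (hcP I).2.symm, hur⟩
            · rcases Finset.mem_union.1 hu with hu | hu
              · obtain ⟨I, hI, rfl⟩ := Finset.mem_image.1 hu; exact ⟨hPA I, (hcP I).1.symm, (hS I hI).1⟩
              · obtain ⟨I, hI, rfl⟩ := Finset.mem_image.1 hu; exact ⟨hP'A I, (hcP I).2.symm, (hS I hI).2⟩
          rcases honly u huA.1 hcu with h | h
          · exact huA.2.1 h
          · exact huA.2.2 h
        simp only [hg]; rw [DecisionTree.ind_of_mem hω, DecisionTree.ind_of_mem this]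
      · simp only [hg]; rw [DecisionTree.ind_of_not_mem hω]; exact DecisionTree.ind_nonneg _ _
    set Φ : ℝ := ∑ S ∈ PS, W S * g S with hΦ
    have hΦnn : 0 ≤ Φ := Finset.sum_nonneg fun S _ => mul_nonneg (hWnn S) (hgnn S)
    -- LHS ≤ C0 · (Σ_{K ∌ r} D_K) · Φ
    have hLHS : ∑ K, D K * ∑ S ∈ PS, W S * DecisionTree.ind (ρ K S) ω ≤
        (∑ K ∈ Finset.univ.filter (fun K => P K ≠ r ∧ P' K ≠ r), D K) * Φ := by
      rw [Finset.sum_mul]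
      rw [← Finset.sum_filter_add_sum_filter_not Finset.univ (fun K => P K ≠ r ∧ P' K ≠ r)]
      have hzero : ∑ K ∈ Finset.univ.filter (fun K => ¬ (P K ≠ r ∧ P' K ≠ r)), D K * ∑ S ∈ PS, W S * DecisionTree.ind (ρ K S) ω = 0 :=
        Finset.sum_eq_zero fun K hK => by
          simp only [hρr K (Finset.mem_filter.1 hK).2, mul_zero, Finset.sum_const_zero]
      rw [hzero, add_zero]
      refine Finset.sum_le_sum fun K _ => mul_le_mul_of_nonneg_left ?_ (hDnn K)
      exact Finset.sum_le_sum fun S _ => mul_le_mul_of_nonneg_left (hρG K S) (hWnn S)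
    -- RHS ≥ (C0 + Σ_{t: r ∉ R_t} b_t) · Φ
    have hRHS : (C0 + ∑ t ∈ Finset.univ.filter (fun t => r ∉ R t), b t) * Φ ≤
        C0 * ∑ S ∈ PS, W S * DecisionTree.ind (G S) ω + ∑ t, b t * ∑ S ∈ PS, W S * DecisionTree.ind (B t S) ω := by
      rw [add_mul]
      refine add_le_add (le_of_eq rfl) ?_
      rw [← Finset.sum_filter_add_sum_filter_not Finset.univ (fun t => r ∉ R t) (fun t => b t * _)]
      have hnn : 0 ≤ ∑ t ∈ Finset.univ.filter (fun t => ¬ (r ∉ R t)), b t * ∑ S ∈ PS, W S * DecisionTree.ind (B t S) ω :=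
        Finset.sum_nonneg fun t _ => mul_nonneg (hb t) (Finset.sum_nonneg fun S _ => mul_nonneg (hWnn S) (DecisionTree.ind_nonneg _ _))
      rw [Finset.sum_mul]
      refine le_trans ?_ (le_add_of_nonneg_right hnn)
      refine Finset.sum_le_sum fun t ht => mul_le_mul_of_nonneg_left ?_ (hb t)
      exact Finset.sum_le_sum fun S _ => mul_le_mul_of_nonneg_left (hBg t (Finset.mem_filter.1 ht).2 S) (hWnn S)
    have h1 := mul_le_mul_of_nonneg_left hLHS hC0
    have h2 := mul_le_mul_of_nonneg_right (hG1 r) hΦnn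
    calc C0 * ∑ K, D K * ∑ S ∈ PS, W S * DecisionTree.ind (ρ K S) ω
        ≤ C0 * ((∑ K ∈ Finset.univ.filter (fun K => P K ≠ r ∧ P' K ≠ r), D K) * Φ) := h1
      _ = (C0 * ∑ K ∈ Finset.univ.filter (fun K => P K ≠ r ∧ P' K ≠ r), D K) * Φ := by ring
      _ ≤ (C0 + ∑ t ∈ Finset.univ.filter (fun t => r ∉ R t), b t) * Φ := h2
      _ ≤ _ := hRHS

end StarSet

end Summit.CriticalPhenomena.PercolationContinuityZ3.Theorems

end
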